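import Literature.MathematicalPhysics.QuantumFieldTheory.Balaban1983to89.B9SmoothHolderClassP

/-!
# `Balaban1983to89.B9SmoothHolderClassPClosure` — INTO the print-weighted BOND class `bHZKP g s` ∕ the graded `bHZKPG g w` from a `𝔠^{(−1)}` sup member and the
# (3.43)₂-LITERAL probe members `Φ^X_s∘T : 𝔠_P^{(s−1)}` — `B9SmoothHolderClassTClosure` §4–§5 with the `(Lʲη)^{1−s}` gain of the probe member KEPT (the
# producer `gXH = G₁∇\*_U` at the pin (P1′) of `BH13-UNITS-MEMO.md`)

T. Bałaban, *Propagators for lattice gauge theories in a background field*, Commun. Math. Phys. **99** (1985) 389–434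
[`Balaban1985BackgroundPropagators`, "B9"]; [4] = T. Bałaban, *Propagators and renormalization transformations for lattice gauge
theories. II*, Commun. Math. Phys. **96** (1984) 223–250 [`Balaban1984PropagatorsII`].

statement-level skeleton of published theorems with citation tags; proofs where landed; nothing here is a claim about the
Yang–Mills mass gap

THE PRINTED LOCI.  [B9] (3.40) p. 397, Thm 3.1 (3.42)–(3.43) pp. 397–398 (*"‖ζ∇_UG′(U)λ‖_β, ‖ζG′(U)∇\*_Uλ‖_β ≦ B₀(β)(Lʲη)^{1−β}(…)e^{−δ₀d}|λ|"*), Thm 3.12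
(3.138) p. 423 (the words of `G₁∇\*_U`); [4] (2.51)–(2.54) pp. 232–233, (2.137) p. 247.

WHY THIS FILE (cell `pub-ymgap`, node N06, seat dag-n06-l g24; repair (A′), the producer INTO the bond pin (P1′) `bXH := bHZKPG (taxiB U) wX`).  At the current pin
(P1) `bXH = bHZKG (taxiB U) (p:=1) wX` the producer `gXH` was DERIVED (g22 `gXH_bHZKG_of_pins`) by `…TClosure.hasMaj_into_bHZKT_of_probeMaj`, which reads a probe member
`Φ_s∘T : b₁ → 𝔠_P^{(s−1)}` — the (3.43)₂-literal shape `|probe| ≤ C_b·(Lʲη)^{1−s}e^{−δd}` — and THROWS THE GAIN AWAY (`((Lʲη)^{s−1})⁻¹ ≤ 1`).  The print-weighted class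
`bHZKP g s = (Lʲη)^{s−1}·‖·‖_{bHZKT g s s}` wants exactly that gain in the seminorm channel and `(Lʲη)¹` in the sup channel.  THIS FILE:
* §1 ★★ `hasMaj_into_bHZKP_of_probeMaj` — `hsup : HasMaj b₁ 𝔠^{(−1)}_{blkBK} T (C·e^{−δd})` ((3.42)₂-type: `|Tμ| ≤ (Lʲη)·C·e^{−δd}`) + `hpr : HasMaj b₁ 𝔠_P^{(s−1)}_{blkPK}
  (probeK b g (wKA s) (w₀K s) ∘ T) (C_b·e^{−δd})` ((3.43)₂ literally) ⟹ `HasMaj b₁ (bHZKP g s) T ((L·C + L^{1−s}·C_b)·e^{δr}·e^{−δd})` — both channels balanced, the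
  level window costs `L^{|·|}` only; ★★ `hasMaj_into_bHZKP_of_probeMaj_near` (radius by `hβ1`);
* §2 ★★ `hasMaj_into_bHZKPG_of_probeFamily` — the ∀ s ∈ (0,1) family lands ONCE in `bHZKPG g w` when `w s·C_b s ≤ C_b₀`: majorant `L·(C + C_b₀)·e^{δ(r_near+1)}·e^{−δd}`
  — the (P1′) producer landing for `gXH` from g22's inputs `he2 ∕ h43 ∕ hpX s` (print's (3.42)₂, (3.43)₂).
HONEST SCOPE.  Bookkeeping over landed objects (`…TClosure` §1–§3 dictionary, the P-classes); the sup and probe members are HYPOTHESES of printed species; nothing of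
[B9]∕[4] asserted; no pin, no certificate edit; COUNT-NEUTRAL; N06 NOT discharged; nothing continuum, nothing about the mass gap.  Cell `pub-ymgap` (HUMAN RULING
D-0062), Track A node N06 [B9], seat `pub-ymgap-dag-n06-l` (g24), 2026-08-29.
-/

noncomputable section

namespace Literature.MathematicalPhysics.QuantumFieldTheory.Balaban1983to89.B9SmoothHolderClassPClosure

open B6GlobalChartV1 (PV blkV1)
open B6Ineq2142KLevelV1 (β lvl)
open B6KLevelCensusIndexV1 (KIdx)
open B6Prop22KLevelTorusCensusEta (nKT one_le_nKT)
open B9GeoNormsKLevelV1 (geo9K)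
open B9GeoLemma21KLevelV1 (geo9K_dist_triangle geo9K_len_pos)
open B9Thm34Ext (toB6)
open B11SectG (BlockNorm HasMaj)
open B11SectGGlobal (Size)
open B11SectGGlobalSizes
open B11SectGSmoothCutT (Size.ofPairsT ofPairsT_sz_le)
open B9SectDSup (weightNorm weightNorm_loc)
open B9Thm312WholeClasses (cNormR cNormR_loc)
open B9CoReadingCoords (XBK blkBK)
open B9CoReadingCoordsS (sIK)
open B9CoReadingCoordsHolder (blkPK probeK wK w₀K)
open B9CoReadingCoordsHolderAdm (wKA)
open B9MultiscaleSmoothPartitionY (NearY levY_window_of_nearY)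
open B9MultiscaleSmoothPartitionYNear (rNear dist_sIK_le_of_nearY)
open B9SmoothHolderClassS (Wscl Wscl_nonneg one_le_Wscl)
open B9SmoothHolderClassK (srcY NearPairK wEtaK wEtaK_nonneg)
open B9SmoothHolderClassT (trDif bHZKT bHZKT_loc)
open B9SmoothHolderClassTClosure (len_le_one len_rpow_neg_eq_Wscl wEtaK_mul_abs_trDif_eq abs_apply_le_of_hasMaj_cNormR)
open B9SmoothHolderClassP (bHZKP bHZKPG hasMaj_into_bHZKPG)
open B9GradViaDivLettersAtPinsHolderPairs (sIK_chartY)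
open B9GradViaDivLettersSmoothTerms (blkV1_level_eq_levY Wscl_le_of_lvl_le)
open Node00 (SiteY FBondY IBondY toKT levY)

variable {d ℓ : ℕ} {hd : 1 ≤ d + 1} {hL : Odd (ℓ + 1) ∧ 1 < ℓ + 1} {b₀ b₁ : ℝ}
variable {𝔸 : Type} [NormedRing 𝔸] [NormedAlgebra ℂ 𝔸]
variable {κ : Type} [Fintype κ]
variable (i : KIdx d ℓ hd hL b₀ b₁) [Fintype (geo9K i).Site] (b : Module.Basis κ ℝ 𝔸) (g : FBondY i → FBondY i → 𝔸ˣ) {R : ℝ} {H : Prop}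
variable (hlen : ∀ y : (geo9K i).Site, 0 ≤ (geo9K i).len y) {bI : FBondY i → IBondY i}
variable {F₁ : Type} [AddCommGroup F₁] [Module ℝ F₁]

/-! ## §1 ★★ INTO `bHZKP g s` from a `𝔠^{(−1)}` sup member and a (3.43)₂-literal probe member -/

/-- ★★ **INTO THE PRINT-WEIGHTED BOND CLASS, GAIN KEPT.**  For ANY source class `b₁`, ANY transporter table `g`, `0 ≤ s ≤ 1`: a sup member `|Tμ| ≤ (Lʲη)·C·e^{−δd}`
(`𝔠^{(−1)}` on the bond carrier, blocks `bI`) and a probe member `|Φ_s(Tμ)| ≤ (Lʲη)^{1−s}·C_b·e^{−δd}` (`𝔠_P^{(s−1)}` on the probe lattice, `Φ_s = probeK b g (wKA s) (w₀K s)`)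
give `HasMaj b₁ (bHZKP g s) T ((L·C + L^{1−s}·C_b)·e^{δr}·e^{−δd})`: the class size `(Lʲη)⁻¹·sup + (Lʲη)^{s−1}·pair_s` reads the sup member in the first channel (one level
window: `L`) and the probe member in the second (`(Lʲ″η)^{1−s} ≤ L^{1−s}(Lʲη)^{1−s}`), each channel exactly balanced.
[cite: Balaban1985BackgroundPropagators, (3.40) p.397 + (3.42)–(3.43) pp.397–398 («B₀(β)(Lʲη)^{1−β}») + Thm 3.12 (3.138) p.423; Balaban1984PropagatorsII, (2.51)–(2.54) pp.232–233, (2.137) p.247] -/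
theorem hasMaj_into_bHZKP_of_probeMaj {s : ℝ} (hs0 : 0 ≤ s) (hs1 : s ≤ 1)
    (hlev : ∀ f : FBondY i, lvl i.hN i.D i.hk (bI f) = (blkV1 i.hN i.D f).1.1) (hbI0 : ∀ f : FBondY i, bI f = bI ⟨f.src, 0⟩)
    {r δ : ℝ} (hδ : 0 ≤ δ) (hN : ∀ (y : IBondY i) (z : SiteY i), NearY i y z → (geo9K i).dist y (sIK i bI z) ≤ r)
    (hcf : |i.cf| = (nKT (toKT i) : ℝ))
    {b₁ : BlockNorm (toB6 (geo9K i) R H) F₁} {T : F₁ →ₗ[ℝ] (XBK κ i → ℝ)} {C Cb : ℝ} (hC : 0 ≤ C) (hCb : 0 ≤ Cb)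
    (hsup : HasMaj b₁ (cNormR R H (blkBK i bI) hlen (-1)) T (fun a a' => C * Real.exp (-(δ * (geo9K i).dist a a'))))
    (hpr : HasMaj b₁ (cNormR R H (blkPK bI) hlen (s - 1)) (probeK b g (wKA i s) (w₀K i s) ∘ₗ T)
      (fun a a' => Cb * Real.exp (-(δ * (geo9K i).dist a a')))) :
    HasMaj b₁ (bHZKP (κ := κ) i b g (R := R) (H := H) (s := s) hs0 hs1) T
      (fun y y' => (((ℓ + 1 : ℕ) : ℝ) * C + (((ℓ + 1 : ℕ) : ℝ)) ^ (1 - s) * Cb) * Real.exp (δ * r) * Real.exp (-(δ * (geo9K i).dist y y'))) := by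
  classical
  intro y' μ hμ y
  rw [bHZKP, weightNorm_loc, bHZKT_loc]
  set L : ℝ := ((ℓ + 1 : ℕ) : ℝ) with hLdef
  have hL1 : 1 ≤ L := by rw [hLdef]; exact_mod_cast Nat.succ_le_succ (Nat.zero_le ℓ)
  have hL0 : 0 < L := lt_of_lt_of_le one_pos hL1
  set Λ : ℝ := (geo9K i).len y with hΛdef
  have hΛ : 0 < Λ := geo9K_len_pos i y
  set E : ℝ := Real.exp (δ * r) * Real.exp (-(δ * (geo9K i).dist y y')) with hE
  have hE0 : 0 ≤ E := by positivity
  have hl0 : 0 ≤ b₁.loc y' μ := b₁.loc_nonneg _ _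
  -- geometry of a point seen from `Δ̃(y)`: its bond's block is within `r` of `y` and one level away (both sides)
  have hgeo : ∀ q : XBK κ i, NearY i y (srcY i q) → (geo9K i).dist y (bI q.1) ≤ r ∧
      lvl i.hN i.D i.hk (bI q.1) ≤ lvl i.hN i.D i.hk y + 1 ∧ lvl i.hN i.D i.hk y ≤ lvl i.hN i.D i.hk (bI q.1) + 1 := by
    intro q hq
    have hsrc : sIK i bI (srcY i q) = bI q.1 := by rw [srcY, sIK_chartY, ← hbI0 q.1]
    have hw := levY_window_of_nearY i hq
    rw [← blkV1_level_eq_levY, ← hlev q.1] at hw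
    exact ⟨by have h := hN y (srcY i q) hq; rwa [hsrc] at h, hw.2, hw.1⟩
  have hexp : ∀ q : XBK κ i, NearY i y (srcY i q) → Real.exp (-(δ * (geo9K i).dist (bI q.1) y')) ≤ E := by
    intro q hq
    rw [hE, ← Real.exp_add]
    refine Real.exp_le_exp.2 ?_
    nlinarith [mul_le_mul_of_nonneg_left (geo9K_dist_triangle i y (bI q.1) y') hδ, mul_le_mul_of_nonneg_left (hgeo q hq).1 hδ]
  -- the length ratio over one level: `len(bI q) ≤ L·Λ` and `len(bI q)^{1−s} ≤ L^{1−s}·Λ^{1−s}`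
  have hratio : ∀ q : XBK κ i, NearY i y (srcY i q) → (geo9K i).len (bI q.1) ≤ L * Λ := by
    intro q hq
    have h1 : Wscl i 1 y ≤ L ^ ((1 : ℝ)) * Wscl i 1 (bI q.1) := by
      have := Wscl_le_of_lvl_le i zero_le_one (k := 1) (hgeo q hq).2.1
      simpa only [Nat.cast_one, one_mul] using this
    rw [Real.rpow_one, ← len_rpow_neg_eq_Wscl i hcf, ← len_rpow_neg_eq_Wscl i hcf, Real.rpow_neg_one, Real.rpow_neg_one] at h1
    have hq0 : 0 < (geo9K i).len (bI q.1) := geo9K_len_pos i _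
    rw [← div_eq_mul_inv] at h1
    have h2 := (le_div_iff₀ hq0).1 h1
    have h3 := (inv_mul_le_iff₀ hΛ).1 h2
    rw [hΛdef, mul_comm]; exact h3
  -- THE SUP CHANNEL: `Wscl(1−s)·Wscl(s)·|Tμ q| ≤ L·C·E·loc`
  have hpt : ∀ q : XBK κ i, NearY i y (srcY i q) → Wscl i (1 - s) y * (Wscl i s y * |T μ q|) ≤ L * C * E * b₁.loc y' μ := by
    intro q hq
    have hv := abs_apply_le_of_hasMaj_cNormR i hlen hsup hμ q
    have hblk : blkBK i bI q = bI q.1 := rfl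
    rw [hblk, Real.rpow_neg_one, inv_inv] at hv
    have hWW : Wscl i (1 - s) y * Wscl i s y = Λ⁻¹ := by
      rw [← len_rpow_neg_eq_Wscl i hcf, ← len_rpow_neg_eq_Wscl i hcf, ← Real.rpow_add hΛ, show -(1 - s) + -s = (-1 : ℝ) by ring, Real.rpow_neg_one]
    calc Wscl i (1 - s) y * (Wscl i s y * |T μ q|) = Λ⁻¹ * |T μ q| := by rw [← mul_assoc, hWW]
      _ ≤ Λ⁻¹ * ((geo9K i).len (bI q.1) * (C * Real.exp (-(δ * (geo9K i).dist (bI q.1) y'))) * b₁.loc y' μ) :=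
          mul_le_mul_of_nonneg_left hv (inv_nonneg.2 hΛ.le)
      _ ≤ Λ⁻¹ * ((L * Λ) * (C * E) * b₁.loc y' μ) :=
          mul_le_mul_of_nonneg_left (mul_le_mul_of_nonneg_right (mul_le_mul (hratio q hq) (mul_le_mul_of_nonneg_left (hexp q hq) hC)
            (by positivity) (by positivity)) hl0) (inv_nonneg.2 hΛ.le)
      _ = L * C * E * b₁.loc y' μ := by field_simp
  have hsupPart : Wscl i (1 - s) y * (Wscl i s y * (Size.ofSup (toB6 (geo9K i) R H) (fun (q : XBK κ i) (y : IBondY i) => NearY i y (srcY i q))).sz y (T μ)) ≤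
      L * C * E * b₁.loc y' μ := by
    have hW1 : 0 < Wscl i (1 - s) y := lt_of_lt_of_le zero_lt_one (one_le_Wscl i (by linarith) y)
    have hWs : 0 < Wscl i s y := lt_of_lt_of_le zero_lt_one (one_le_Wscl i hs0 y)
    have hM0 : 0 ≤ (Wscl i (1 - s) y * Wscl i s y)⁻¹ * (L * C * E * b₁.loc y' μ) := by positivity
    have h1 : (Size.ofSup (toB6 (geo9K i) R H) (fun (q : XBK κ i) (y : IBondY i) => NearY i y (srcY i q))).sz y (T μ) ≤
        (Wscl i (1 - s) y * Wscl i s y)⁻¹ * (L * C * E * b₁.loc y' μ) :=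
      ofSup_sz_le _ hM0 fun q hq => by
        rw [le_inv_mul_iff₀ (mul_pos hW1 hWs), mul_assoc]
        exact hpt q hq
    calc _ ≤ Wscl i (1 - s) y * (Wscl i s y * ((Wscl i (1 - s) y * Wscl i s y)⁻¹ * (L * C * E * b₁.loc y' μ))) :=
          mul_le_mul_of_nonneg_left (mul_le_mul_of_nonneg_left h1 hWs.le) hW1.le
      _ = _ := by field_simp
  -- THE SEMINORM CHANNEL: `Wscl(1−s)·wEtaK s·|trDif| ≤ L^{1−s}·C_b·E·loc`
  have hpair : ∀ q q' : XBK κ i, NearY i y (srcY i q) → NearPairK i q q' →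
      Wscl i (1 - s) y * (wEtaK i s q q' * |trDif b g q q' (T μ)|) ≤ L ^ (1 - s) * Cb * E * b₁.loc y' μ := by
    intro q q' hq hqq
    rw [wEtaK_mul_abs_trDif_eq i b hcf g s (T μ) hqq, ← LinearMap.comp_apply]
    have hv : |(probeK b g (wKA i s) (w₀K i s) ∘ₗ T) μ (Sum.inl ((q.1, q'.1), q.2))| ≤
        ((geo9K i).len (bI q.1) ^ (s - 1))⁻¹ * (Cb * Real.exp (-(δ * (geo9K i).dist (bI q.1) y'))) * b₁.loc y' μ :=
      abs_apply_le_of_hasMaj_cNormR i hlen hpr hμ (Sum.inl ((q.1, q'.1), q.2))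
    have hq0 : 0 < (geo9K i).len (bI q.1) := geo9K_len_pos i _
    have hgain : Wscl i (1 - s) y * ((geo9K i).len (bI q.1) ^ (s - 1))⁻¹ ≤ L ^ (1 - s) := by
      have e1 : Wscl i (1 - s) y = ((geo9K i).len y ^ (1 - s))⁻¹ := by rw [← len_rpow_neg_eq_Wscl i hcf, Real.rpow_neg hΛ.le]
      have e2 : ((geo9K i).len (bI q.1) ^ (s - 1))⁻¹ = (geo9K i).len (bI q.1) ^ (1 - s) := by rw [← Real.rpow_neg hq0.le, neg_sub]
      rw [e1, e2, inv_mul_eq_div, ← Real.div_rpow hq0.le hΛ.le]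
      exact Real.rpow_le_rpow (div_nonneg hq0.le hΛ.le) ((div_le_iff₀ hΛ).2 (hratio q hq)) (by linarith)
    have hCe : Cb * Real.exp (-(δ * (geo9K i).dist (bI q.1) y')) ≤ Cb * E := mul_le_mul_of_nonneg_left (hexp q hq) hCb
    calc Wscl i (1 - s) y * |(probeK b g (wKA i s) (w₀K i s) ∘ₗ T) μ (Sum.inl ((q.1, q'.1), q.2))|
        ≤ Wscl i (1 - s) y * (((geo9K i).len (bI q.1) ^ (s - 1))⁻¹ * (Cb * Real.exp (-(δ * (geo9K i).dist (bI q.1) y'))) * b₁.loc y' μ) :=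
          mul_le_mul_of_nonneg_left hv (Wscl_nonneg i _ y)
      _ = (Wscl i (1 - s) y * ((geo9K i).len (bI q.1) ^ (s - 1))⁻¹) * (Cb * Real.exp (-(δ * (geo9K i).dist (bI q.1) y'))) * b₁.loc y' μ := by ring
      _ ≤ L ^ (1 - s) * (Cb * E) * b₁.loc y' μ := mul_le_mul_of_nonneg_right (mul_le_mul hgain hCe (by positivity) (by positivity)) hl0
      _ = _ := by ring
  have hpairPart : Wscl i (1 - s) y * (Size.ofPairsT (toB6 (geo9K i) R H) (fun (q : XBK κ i) (y : IBondY i) => NearY i y (srcY i q)) (NearPairK i) (wEtaK i s)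
        (wEtaK_nonneg i s) (trDif b g)).sz y (T μ) ≤ L ^ (1 - s) * Cb * E * b₁.loc y' μ := by
    have hW1 : 0 < Wscl i (1 - s) y := lt_of_lt_of_le zero_lt_one (one_le_Wscl i (by linarith) y)
    have hM0 : 0 ≤ (Wscl i (1 - s) y)⁻¹ * (L ^ (1 - s) * Cb * E * b₁.loc y' μ) := by positivity
    have h1 := ofPairsT_sz_le (fun (q : XBK κ i) (y : IBondY i) => NearY i y (srcY i q)) (NearPairK i) (wEtaK i s) (wEtaK_nonneg i s) (trDif b g)
      (g := toB6 (geo9K i) R H) (y := y) (f := T μ) hM0 fun q q' hq hqq => by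
        rw [le_inv_mul_iff₀ hW1]; exact hpair q q' hq hqq
    calc _ ≤ Wscl i (1 - s) y * ((Wscl i (1 - s) y)⁻¹ * (L ^ (1 - s) * Cb * E * b₁.loc y' μ)) := mul_le_mul_of_nonneg_left h1 hW1.le
      _ = _ := by field_simp
  rw [mul_add]
  calc _ ≤ L * C * E * b₁.loc y' μ + L ^ (1 - s) * Cb * E * b₁.loc y' μ := add_le_add hsupPart hpairPart
    _ = _ := by rw [hE]; ring

/-- ★★ §1 with the LAYER-B radius discharged (`r := r_near + 1`, binder `hβ1`). [cite: Balaban1985BackgroundPropagators, (3.40) p.397 + (3.42)–(3.43) pp.397–398; Balaban1984PropagatorsII, (2.46) p.231 + (2.51)–(2.54) pp.232–233] -/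
theorem hasMaj_into_bHZKP_of_probeMaj_near {s : ℝ} (hs0 : 0 ≤ s) (hs1 : s ≤ 1)
    (hβ1 : ∀ f : FBondY i, (B6Geom246MultiLevelTorus.geomT i.D).dist (β i.hN i.D i.hk (bI f)) (blkV1 i.hN i.D f) ≤ 1)
    (hlev : ∀ f : FBondY i, lvl i.hN i.D i.hk (bI f) = (blkV1 i.hN i.D f).1.1) (hbI0 : ∀ f : FBondY i, bI f = bI ⟨f.src, 0⟩)
    {δ : ℝ} (hδ : 0 ≤ δ) (hcf : |i.cf| = (nKT (toKT i) : ℝ))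
    {b₁ : BlockNorm (toB6 (geo9K i) R H) F₁} {T : F₁ →ₗ[ℝ] (XBK κ i → ℝ)} {C Cb : ℝ} (hC : 0 ≤ C) (hCb : 0 ≤ Cb)
    (hsup : HasMaj b₁ (cNormR R H (blkBK i bI) hlen (-1)) T (fun a a' => C * Real.exp (-(δ * (geo9K i).dist a a'))))
    (hpr : HasMaj b₁ (cNormR R H (blkPK bI) hlen (s - 1)) (probeK b g (wKA i s) (w₀K i s) ∘ₗ T)
      (fun a a' => Cb * Real.exp (-(δ * (geo9K i).dist a a')))) :
    HasMaj b₁ (bHZKP (κ := κ) i b g (R := R) (H := H) (s := s) hs0 hs1) T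
      (fun y y' => (((ℓ + 1 : ℕ) : ℝ) * C + (((ℓ + 1 : ℕ) : ℝ)) ^ (1 - s) * Cb) * Real.exp (δ * (rNear d ℓ + 1)) * Real.exp (-(δ * (geo9K i).dist y y'))) :=
  hasMaj_into_bHZKP_of_probeMaj i b g hlen hs0 hs1 hlev hbI0 hδ (fun _ _ h => dist_sIK_le_of_nearY i hβ1 h) hcf hC hCb hsup hpr

/-! ## §2 ★★ The ∀s probe family lands ONCE in the graded print-weighted bond class -/

/-- ★★ **THE (P1′) PRODUCER LANDING FROM A PROBE FAMILY**: a `𝔠^{(−1)}` sup member (`C·e^{−δd}`) plus an ∀ s ∈ (0,1) family of (3.43)₂-literal probe members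
(`C_b(s)·e^{−δd}`, `B₀(s) → ∞` allowed) is bounded INTO `bHZKPG g w` with majorant `L·(C + C_b₀)·e^{δ(r_near+1)}·e^{−δd}` as soon as `w s·C_b(s) ≤ C_b₀` (`L^{1−s} ≤ L`).
[cite: Balaban1985BackgroundPropagators, Thm 3.1 p.397 («B₀(β) → ∞ if β → 1») + (3.43) p.398 + Thm 3.12 (3.138) p.423; Balaban1984PropagatorsII, (2.51)–(2.54) pp.232–233] -/
theorem hasMaj_into_bHZKPG_of_probeFamily (w : ℝ → ℝ) (hw0 : ∀ s, 0 ≤ w s) (hw1 : ∀ s, w s ≤ 1)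
    (hβ1 : ∀ f : FBondY i, (B6Geom246MultiLevelTorus.geomT i.D).dist (β i.hN i.D i.hk (bI f)) (blkV1 i.hN i.D f) ≤ 1)
    (hlev : ∀ f : FBondY i, lvl i.hN i.D i.hk (bI f) = (blkV1 i.hN i.D f).1.1) (hbI0 : ∀ f : FBondY i, bI f = bI ⟨f.src, 0⟩)
    {δ : ℝ} (hδ : 0 ≤ δ) (hcf : |i.cf| = (nKT (toKT i) : ℝ))
    {b₁ : BlockNorm (toB6 (geo9K i) R H) F₁} {T : F₁ →ₗ[ℝ] (XBK κ i → ℝ)} {C Cb₀ : ℝ} {Cb : ℝ → ℝ} (hC : 0 ≤ C) (hCb₀ : 0 ≤ Cb₀)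
    (hCb : ∀ s, 0 < s → s < 1 → 0 ≤ Cb s) (hwCb : ∀ s, 0 < s → s < 1 → w s * Cb s ≤ Cb₀)
    (hsup : HasMaj b₁ (cNormR R H (blkBK i bI) hlen (-1)) T (fun a a' => C * Real.exp (-(δ * (geo9K i).dist a a'))))
    (hpr : ∀ s, 0 < s → s < 1 → HasMaj b₁ (cNormR R H (blkPK bI) hlen (s - 1)) (probeK b g (wKA i s) (w₀K i s) ∘ₗ T)
      (fun a a' => Cb s * Real.exp (-(δ * (geo9K i).dist a a')))) :
    HasMaj b₁ (bHZKPG (κ := κ) i b g (R := R) (H := H) w hw0 hw1) T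
      (fun y y' => ((ℓ + 1 : ℕ) : ℝ) * (C + Cb₀) * Real.exp (δ * (rNear d ℓ + 1)) * Real.exp (-(δ * (geo9K i).dist y y'))) := by
  have hL1 : (1 : ℝ) ≤ ((ℓ + 1 : ℕ) : ℝ) := by exact_mod_cast Nat.succ_le_succ (Nat.zero_le ℓ)
  have hL0 : (0 : ℝ) ≤ ((ℓ + 1 : ℕ) : ℝ) := le_trans zero_le_one hL1
  refine hasMaj_into_bHZKPG i b g w hw0 hw1
    (K := fun s y y' => (((ℓ + 1 : ℕ) : ℝ) * C + (((ℓ + 1 : ℕ) : ℝ)) ^ (1 - s) * Cb s) * Real.exp (δ * (rNear d ℓ + 1)) * Real.exp (-(δ * (geo9K i).dist y y')))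
    (fun _ _ => by positivity) (fun s hs0 hs1 a c => ?_) fun s hs0 hs1 =>
      hasMaj_into_bHZKP_of_probeMaj_near i b g hlen hs0.le hs1.le hβ1 hlev hbI0 hδ hcf hC (hCb s hs0 hs1) hsup (hpr s hs0 hs1)
  have hLs : (((ℓ + 1 : ℕ) : ℝ)) ^ (1 - s) ≤ ((ℓ + 1 : ℕ) : ℝ) := by
    conv_rhs => rw [← Real.rpow_one (((ℓ + 1 : ℕ) : ℝ))]
    exact Real.rpow_le_rpow_of_exponent_le hL1 (by linarith)
  have h1 : w s * (((ℓ + 1 : ℕ) : ℝ) * C) ≤ ((ℓ + 1 : ℕ) : ℝ) * C := mul_le_of_le_one_left (mul_nonneg hL0 hC) (hw1 s)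
  have h2 : w s * ((((ℓ + 1 : ℕ) : ℝ)) ^ (1 - s) * Cb s) ≤ ((ℓ + 1 : ℕ) : ℝ) * Cb₀ := by
    calc w s * ((((ℓ + 1 : ℕ) : ℝ)) ^ (1 - s) * Cb s) = (((ℓ + 1 : ℕ) : ℝ)) ^ (1 - s) * (w s * Cb s) := by ring
      _ ≤ ((ℓ + 1 : ℕ) : ℝ) * Cb₀ := mul_le_mul hLs (hwCb s hs0 hs1) (mul_nonneg (hw0 s) (hCb s hs0 hs1)) hL0
  have hE0 : 0 ≤ Real.exp (δ * (rNear d ℓ + 1)) * Real.exp (-(δ * (geo9K i).dist a c)) := by positivity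
  calc w s * ((((ℓ + 1 : ℕ) : ℝ) * C + (((ℓ + 1 : ℕ) : ℝ)) ^ (1 - s) * Cb s) * Real.exp (δ * (rNear d ℓ + 1)) * Real.exp (-(δ * (geo9K i).dist a c)))
      = (w s * (((ℓ + 1 : ℕ) : ℝ) * C) + w s * ((((ℓ + 1 : ℕ) : ℝ)) ^ (1 - s) * Cb s)) * (Real.exp (δ * (rNear d ℓ + 1)) * Real.exp (-(δ * (geo9K i).dist a c))) := by
        ring
    _ ≤ (((ℓ + 1 : ℕ) : ℝ) * C + ((ℓ + 1 : ℕ) : ℝ) * Cb₀) * (Real.exp (δ * (rNear d ℓ + 1)) * Real.exp (-(δ * (geo9K i).dist a c))) :=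
        mul_le_mul_of_nonneg_right (add_le_add h1 h2) hE0
    _ = _ := by ring

end Literature.MathematicalPhysics.QuantumFieldTheory.Balaban1983to89.B9SmoothHolderClassPClosure

end
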